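import Summits.PneNP.PneNP.Theses.DescentTower

/-!
# Route DescentTower — `FixingAbsorption` (stmt-PneNP-2543)

Singleton (nested-fixing) cohomological `k`-consistency follows from plain cohomological `2k`-consistency: from the
`2k`-family `H₂` take `H = {(U, t) ∈ H₂ : |U| ≤ k}` and, for `p = (C, s) ∈ H`, the sub-family
`H'_p = {(V, t) : |V| ≤ k, t ≡ s on V ∩ C, (V ∪ C, t ∪ s) ∈ H₂}`; the `ℤ`-section of `(V ∪ C, t ∪ s)` pushed forward
along `w ↦ w|_U` (`r U τ = Σ_{w ≡ τ on U, w ≡ s on C} r₂ (U ∪ C) w`) is supported in `H'_p` and marginalises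
correctly (one application of the `2k`-marginalisation from `U ∪ C` to `D ∪ C`).
-/

set_option linter.dupNamespace false -- `Summit.PneNP.PneNP.…`: summit = sub-problem name (D-0017 single-conjunct layout)

namespace Summit.PneNP.PneNP.Theorems

open Finset

/-- A sum of `[P b] · f b` whose predicate pins `b` down: `P b ↔ b = b₀ ∧ R`. [folklore] -/
theorem descentTower_sum_ite_eq_of_iff {β : Type*} [Fintype β] {P : β → Prop} [DecidablePred P] {R : Prop}
    [Decidable R] (f : β → ℤ) (b₀ : β) (h : ∀ b, P b ↔ b = b₀ ∧ R) :
    (∑ b, if P b then f b else 0) = if R then f b₀ else 0 := by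
  by_cases hR : R
  · rw [if_pos hR, Finset.sum_eq_single b₀]
    · rw [if_pos ((h b₀).2 ⟨rfl, hR⟩)]
    · intro b _ hb; exact if_neg fun hP => hb ((h b).1 hP).1
    · intro hb; exact absurd (Finset.mem_univ _) hb
  · rw [if_neg hR]
    exact Finset.sum_eq_zero fun b _ => if_neg fun hP => hR ((h b).1 hP).2

/-- Pushing a conditional into a sum. [folklore] -/
theorem descentTower_ite_sum {β : Type*} (P : Prop) [Decidable P] (f : β → ℤ) (S : Finset β) :
    (if P then ∑ b ∈ S, f b else 0) = ∑ b ∈ S, if P then f b else 0 := by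
  split_ifs <;> simp

/-- **Marginalisation of the pushed-forward section.** With `r U τ = [|U| ≤ k ∧ τ ≡ 0 off U] · Σ_w [w ≡ τ on U ∧ w ≡ s on C]
· r₂ (U ∪ C) w`, where `r₂` marginalises at width `2k` and `|C| ≤ k`: for `D ⊆ U`, `|U| ≤ k`,
`r D τ' = Σ_τ [τ' = τ|_D] · r U τ`. [folklore] -/
theorem descentTower_pushforward_marginal {n : ℕ} (k : ℕ) (C : Finset (Fin n)) (s : Fin n → Fin 3)
    (r₂ : Finset (Fin n) → (Fin n → Fin 3) → ℤ)
    (hr₂ : ∀ U D : Finset (Fin n), D ⊆ U → U.card ≤ 2 * k → ∀ t' : Fin n → Fin 3,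
      r₂ D t' = ∑ t : Fin n → Fin 3, if (∀ v, t' v = if v ∈ D then t v else 0) then r₂ U t else 0)
    (hC : C.card ≤ k) (U D : Finset (Fin n)) (hDU : D ⊆ U) (hU : U.card ≤ k) (τ' : Fin n → Fin 3) :
    (if D.card ≤ k ∧ (∀ v, v ∉ D → τ' v = 0) then
        ∑ w : Fin n → Fin 3, (if (∀ v ∈ D, w v = τ' v) ∧ (∀ v ∈ C, w v = s v) then r₂ (D ∪ C) w else 0) else 0) =
      ∑ τ : Fin n → Fin 3, if (∀ v, τ' v = if v ∈ D then τ v else 0) then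
        (if U.card ≤ k ∧ (∀ v, v ∉ U → τ v = 0) then
          ∑ w : Fin n → Fin 3, (if (∀ v ∈ U, w v = τ v) ∧ (∀ v ∈ C, w v = s v) then r₂ (U ∪ C) w else 0) else 0)
        else 0 := by
  classical
  by_cases hz : ∀ v, v ∉ D → τ' v = 0
  swap
  · push Not at hz
    obtain ⟨v, hvD, hv⟩ := hz
    rw [if_neg fun h => hv (h.2 v hvD)]
    refine (Finset.sum_eq_zero fun τ _ => if_neg fun h => hv ?_).symm
    simpa [hvD] using h v
  have hD : D.card ≤ k := (card_le_card hDU).trans hU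
  have hsub : D ∪ C ⊆ U ∪ C := union_subset_union hDU (Subset.refl C)
  have hcard : (U ∪ C).card ≤ 2 * k := (card_union_le U C).trans (by omega)
  rw [if_pos ⟨hD, hz⟩]
  trans ∑ w' : Fin n → Fin 3, if (∀ v ∈ D, w' v = τ' v) ∧ (∀ v ∈ C, w' v = s v) then r₂ (U ∪ C) w' else 0
  · -- expand `r₂ (D ∪ C) w` from `U ∪ C` and collapse the sum over `w`
    have h1 : ∀ w : Fin n → Fin 3,
        (if (∀ v ∈ D, w v = τ' v) ∧ (∀ v ∈ C, w v = s v) then r₂ (D ∪ C) w else 0) =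
          ∑ w' : Fin n → Fin 3, if ((∀ v ∈ D, w v = τ' v) ∧ (∀ v ∈ C, w v = s v)) ∧
              (∀ v, w v = if v ∈ D ∪ C then w' v else 0) then r₂ (U ∪ C) w' else 0 := by
      intro w
      rw [hr₂ (U ∪ C) (D ∪ C) hsub hcard w, descentTower_ite_sum]
      refine Finset.sum_congr rfl fun w' _ => ?_
      rw [← ite_and]
    rw [Finset.sum_congr rfl fun w _ => h1 w, Finset.sum_comm]
    refine Finset.sum_congr rfl fun w' _ => ?_
    refine descentTower_sum_ite_eq_of_iff (fun _ => r₂ (U ∪ C) w') (fun v => if v ∈ D ∪ C then w' v else 0) fun w => ?_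
    constructor
    · rintro ⟨⟨hwD, hwC⟩, hw⟩
      refine ⟨funext hw, fun v hv => ?_, fun v hv => ?_⟩
      · rw [← hwD v hv, hw v, if_pos (mem_union_left C hv)]
      · rw [← hwC v hv, hw v, if_pos (mem_union_right D hv)]
    · rintro ⟨rfl, hD', hC'⟩
      refine ⟨⟨fun v hv => ?_, fun v hv => ?_⟩, fun v => rfl⟩
      · dsimp only; rw [if_pos (mem_union_left C hv), hD' v hv]
      · dsimp only; rw [if_pos (mem_union_right D hv), hC' v hv]
  · -- collapse the sum over `τ` on the right
    symm
    have h2 : ∀ τ : Fin n → Fin 3,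
        (if (∀ v, τ' v = if v ∈ D then τ v else 0) then
          (if U.card ≤ k ∧ (∀ v, v ∉ U → τ v = 0) then
            ∑ w : Fin n → Fin 3, (if (∀ v ∈ U, w v = τ v) ∧ (∀ v ∈ C, w v = s v) then r₂ (U ∪ C) w else 0) else 0)
          else 0) =
        ∑ w' : Fin n → Fin 3, if ((∀ v, τ' v = if v ∈ D then τ v else 0) ∧ (U.card ≤ k ∧ ∀ v, v ∉ U → τ v = 0)) ∧
            ((∀ v ∈ U, w' v = τ v) ∧ ∀ v ∈ C, w' v = s v) then r₂ (U ∪ C) w' else 0 := by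
      intro τ
      rw [← ite_and, descentTower_ite_sum]
      refine Finset.sum_congr rfl fun w' _ => ?_
      rw [← ite_and]
    rw [Finset.sum_congr rfl fun τ _ => h2 τ, Finset.sum_comm]
    refine Finset.sum_congr rfl fun w' _ => ?_
    refine descentTower_sum_ite_eq_of_iff (fun _ => r₂ (U ∪ C) w') (fun v => if v ∈ U then w' v else 0) fun τ => ?_
    constructor
    · rintro ⟨⟨hT, -, hZ⟩, hwU, hwC⟩
      refine ⟨funext fun v => ?_, fun v hv => ?_, hwC⟩
      · by_cases hv : v ∈ U
        · rw [if_pos hv, hwU v hv]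
        · rw [if_neg hv, hZ v hv]
      · rw [hT v, if_pos hv, hwU v (hDU hv)]
    · rintro ⟨rfl, hD', hC'⟩
      refine ⟨⟨fun v => ?_, hU, fun v hv => if_neg hv⟩, fun v hv => (if_pos hv).symm, hC'⟩
      dsimp only
      by_cases hv : v ∈ D
      · rw [if_pos hv, if_pos (hDU hv), hD' v hv]
      · rw [if_neg hv, hz v hv]

/-- **`FixingAbsorption` (stmt-PneNP-2543)**: plain cohomological `2k`-consistency already gives singleton-fixing
`k`-consistency — restrict the family to width `k`; for a member `p = (C, s)` keep the `p`-compatible `(V, t)` whose join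
`(V ∪ C, t ∪ s)` lies in the `2k`-family; sections are pushed forward from the joins. [folklore] -/
theorem descentTower_fixingAbsorption_proof : Summit.PneNP.PneNP.Theses.DescentTower.FixingAbsorption := by
  classical
  rintro n G k ⟨H2, ⟨p₀, hp₀⟩, hH2⟩
  refine ⟨{q | q.1.card ≤ k ∧ q ∈ H2}, ?_, ?_, ?_⟩
  · -- nonempty: the empty restriction of any member
    obtain ⟨-, -, -, hres, -⟩ := hH2 p₀ hp₀
    exact ⟨(∅, fun v => if v ∈ (∅ : Finset (Fin n)) then p₀.2 v else 0), by simp, hres ∅ (empty_subset _)⟩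
  · -- the width-`k` family is a `k`-family
    rintro ⟨V, t⟩ ⟨hVk, hVt⟩
    obtain ⟨-, h0, hpr, hres, hext, -⟩ := hH2 _ hVt
    refine ⟨hVk, h0, hpr, fun D hD => ⟨(card_le_card hD).trans hVk, hres D hD⟩, fun hlt x => ?_⟩
    obtain ⟨t', ht', hagree⟩ := hext (by simp only at hlt ⊢; omega) x
    exact ⟨t', ⟨(card_insert_le x V).trans (by simpa using hlt), ht'⟩, hagree⟩
  · -- singleton fixing
    rintro ⟨C, s⟩ ⟨hCk, hCs⟩
    simp only at hCk
    obtain ⟨-, hs0, -, hCres, -, -⟩ := hH2 _ hCs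
    -- the join with `s` and the sub-family of `p`-compatible members
    set J : Finset (Fin n) → (Fin n → Fin 3) → Fin n → Fin 3 :=
      fun V t v => if v ∈ V then t v else if v ∈ C then s v else 0 with hJ
    refine ⟨{q | q.1.card ≤ k ∧ (∀ v, v ∉ q.1 → q.2 v = 0) ∧ (∀ v ∈ q.1, v ∈ C → q.2 v = s v) ∧ (q.1 ∪ C, J q.1 q.2) ∈ H2},
      ?_, ?_, ?_⟩
    · -- `H' ⊆ H`
      rintro ⟨V, t⟩ ⟨hVk, ht0, -, hm⟩
      simp only at hVk ht0 hm
      obtain ⟨-, -, -, hres, -⟩ := hH2 _ hm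
      have h := hres V subset_union_left
      have e : (fun v => if v ∈ V then J V t v else 0) = t := by
        funext v
        by_cases hv : v ∈ V
        · simp [hJ, hv]
        · rw [if_neg hv, ht0 v hv]
      rw [e] at h
      exact ⟨hVk, h⟩
    · -- `p ∈ H'`
      refine ⟨hCk, hs0, fun v _ _ => rfl, ?_⟩
      have e : J C s = s := by
        funext v
        by_cases hv : v ∈ C
        · simp [hJ, hv]
        · simp only [hJ, if_neg hv]; exact (hs0 v hv).symm
      simp only [union_idempotent, e]
      exact hCs
    · -- the members of `H'`
      rintro ⟨V, t⟩ ⟨hVk, ht0, hcomp, hm⟩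
      simp only at hVk ht0 hcomp hm ⊢
      obtain ⟨-, hj0, -, hjres, hjext, r₂, hr₂s, hr₂m, hr₂1, hr₂0⟩ := hH2 _ hm
      refine ⟨hcomp, fun D hD => ?_, fun hlt x => ?_, ?_⟩
      · -- restriction
        simp only [Set.mem_setOf_eq]
        refine ⟨(card_le_card hD).trans hVk, fun v hv => if_neg hv, fun v hv hvC => by rw [if_pos hv, hcomp v (hD hv) hvC], ?_⟩
        have h := hjres (D ∪ C) (union_subset_union hD (Subset.refl C))
        have e : (fun v => if v ∈ D ∪ C then J V t v else 0) = J D (fun v => if v ∈ D then t v else 0) := by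
          funext v
          by_cases hvD : v ∈ D
          · simp [hJ, hvD, hD hvD]
          · by_cases hvC : v ∈ C
            · by_cases hvV : v ∈ V
              · simp [hJ, hvD, hvC, hvV, hcomp v hvV hvC]
              · simp [hJ, hvD, hvC, hvV]
            · simp [hJ, hvD, hvC]
        rw [e] at h
        exact h
      · -- extension below width `k`
        by_cases hxV : x ∈ V
        · exact ⟨t, ⟨by rwa [insert_eq_of_mem hxV], fun v hv => ht0 v (by rwa [insert_eq_of_mem hxV] at hv),
            fun v hv hvC => hcomp v (by rwa [insert_eq_of_mem hxV] at hv) hvC, by rwa [insert_eq_of_mem hxV]⟩,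
            fun v _ => rfl⟩
        by_cases hxC : x ∈ C
        · simp only [Set.mem_setOf_eq]
          refine ⟨fun v => if v = x then s x else t v, ⟨(card_insert_le x V).trans (by omega), fun v hv => ?_,
            fun v hv hvC => ?_, ?_⟩, fun v hv => ?_⟩
          · rw [mem_insert, not_or] at hv
            dsimp only
            rw [if_neg hv.1, ht0 v hv.2]
          · dsimp only
            by_cases hvx : v = x
            · subst hvx; rw [if_pos rfl]
            · rw [if_neg hvx, hcomp v ((mem_insert.1 hv).resolve_left hvx) hvC]
          · have e1 : insert x V ∪ C = V ∪ C := by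
              rw [insert_union]; exact insert_eq_of_mem (mem_union_right V hxC)
            have e2 : J (insert x V) (fun v => if v = x then s x else t v) = J V t := by
              funext v
              by_cases hvx : v = x
              · subst hvx; simp [hJ, hxV, hxC]
              · simp [hJ, hvx]
            rw [e1, e2]
            exact hm
          · dsimp only
            rw [if_neg (fun h : v = x => hxV (h ▸ hv))]
        · have hcard : (V ∪ C).card < 2 * k := (card_union_le V C).trans_lt (by omega)
          obtain ⟨w, hw, hwagree⟩ := hjext hcard x
          obtain ⟨-, -, -, hwres, -⟩ := hH2 _ hw
          simp only [Set.mem_setOf_eq]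
          refine ⟨fun v => if v ∈ insert x V then w v else 0, ⟨(card_insert_le x V).trans (by omega),
            fun v hv => if_neg hv, fun v hv hvC => ?_, ?_⟩, fun v hv => ?_⟩
          · have hvx : v ≠ x := fun h => hxC (h ▸ hvC)
            have hvV : v ∈ V := (mem_insert.1 hv).resolve_left hvx
            dsimp only
            rw [if_pos hv, hwagree v (mem_union_left C hvV), ← hcomp v hvV hvC]
            simp [hJ, hvV]
          · have h := hwres (insert x (V ∪ C)) (Subset.refl _)
            have e1 : insert x V ∪ C = insert x (V ∪ C) := insert_union x V C
            have e2 : J (insert x V) (fun v => if v ∈ insert x V then w v else 0) =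
                fun v => if v ∈ insert x (V ∪ C) then w v else 0 := by
              funext v
              by_cases hvx : v = x
              · subst hvx; simp [hJ]
              · by_cases hvV : v ∈ V
                · simp [hJ, hvx, hvV]
                · by_cases hvC : v ∈ C
                  · simp [hJ, hvx, hvV, hvC, hwagree v (mem_union_right V hvC)]
                  · simp [hJ, hvx, hvV, hvC]
            rw [e1, e2]
            exact h
          · dsimp only
            rw [if_pos (mem_insert_of_mem hv), hwagree v (mem_union_left C hv)]
            simp [hJ, hv]
      · -- the pushed-forward section
        refine ⟨fun X σ => if X.card ≤ k ∧ (∀ v, v ∉ X → σ v = 0) then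
            ∑ w : Fin n → Fin 3, (if (∀ v ∈ X, w v = σ v) ∧ (∀ v ∈ C, w v = s v) then r₂ (X ∪ C) w else 0) else 0,
          fun X σ hne => ?_, fun U' D hDU hU' τ' => descentTower_pushforward_marginal k C s r₂ hr₂m hCk U' D hDU hU' τ', ?_, ?_⟩
        · -- support
          simp only [Set.mem_setOf_eq] at hne ⊢
          have hX : X.card ≤ k ∧ ∀ v, v ∉ X → σ v = 0 := by by_contra h; exact hne (if_neg h)
          rw [if_pos hX] at hne
          obtain ⟨w, -, hw⟩ := Finset.exists_ne_zero_of_sum_ne_zero hne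
          have hwc : (∀ v ∈ X, w v = σ v) ∧ ∀ v ∈ C, w v = s v := by by_contra h; exact hw (if_neg h)
          rw [if_pos hwc] at hw
          obtain ⟨-, -, -, hwres, -⟩ := hH2 _ (hr₂s _ _ hw)
          have h := hwres (X ∪ C) (Subset.refl _)
          have e : (fun v => if v ∈ X ∪ C then w v else 0) = J X σ := by
            funext v
            by_cases hvX : v ∈ X
            · simp [hJ, hvX, hwc.1 v hvX]
            · by_cases hvC : v ∈ C
              · simp [hJ, hvX, hvC, hwc.2 v hvC]
              · simp [hJ, hvX, hvC]
          rw [e] at h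
          exact ⟨hX.1, hX.2, fun v hvX hvC => by rw [← hwc.1 v hvX, hwc.2 v hvC], h⟩
        · -- value `1` at `q`
          show (if V.card ≤ k ∧ (∀ v, v ∉ V → t v = 0) then
            ∑ w : Fin n → Fin 3, (if (∀ v ∈ V, w v = t v) ∧ (∀ v ∈ C, w v = s v) then r₂ (V ∪ C) w else 0) else 0) = 1
          rw [if_pos ⟨hVk, ht0⟩, Finset.sum_eq_single (J V t)]
          · rw [if_pos, hr₂1]
            refine ⟨fun v hv => by simp [hJ, hv], fun v hv => ?_⟩
            by_cases hvV : v ∈ V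
            · simp [hJ, hvV, hcomp v hvV hv]
            · simp [hJ, hvV, hv]
          · intro w _ hw
            rw [hr₂0 w hw, ite_self]
          · intro h; exact absurd (mem_univ _) h
        · -- value `0` elsewhere on `q.1`
          intro τ hτ
          show (if V.card ≤ k ∧ (∀ v, v ∉ V → τ v = 0) then
            ∑ w : Fin n → Fin 3, (if (∀ v ∈ V, w v = τ v) ∧ (∀ v ∈ C, w v = s v) then r₂ (V ∪ C) w else 0) else 0) = 0
          split_ifs with hV
          · refine Finset.sum_eq_zero fun w _ => ?_
            by_cases hw : w = J V t
            · subst hw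
              rw [if_neg]
              rintro ⟨hV', -⟩
              apply hτ
              funext v
              by_cases hv : v ∈ V
              · rw [← hV' v hv]; simp [hJ, hv]
              · rw [hV.2 v hv, ht0 v hv]
            · rw [hr₂0 w hw, ite_self]
          · rfl

end Summit.PneNP.PneNP.Theorems
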